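import Literature.MathematicalPhysics.QuantumFieldTheory.Balaban1983to89.B1Ineq18RegularRegion
import Literature.MathematicalPhysics.QuantumFieldTheory.Balaban1983to89.B1Cor23ZeroFieldRegion

/-!
# `Balaban1983to89.B1Cor23RegularRegion` — T. Bałaban, *Regularity and decay of lattice Green's functions*, Commun. Math.
# Phys. **89** (1983) 571–597 [Balaban1983RegularityDecay], **COROLLARY 2.3 (2.30), FIRST PAIRING, AT A REGULAR `A ≠ 0` FOR REGIONS
# `Ω ⊂ T_ε`** (any union of `k`-fold blocks of the torus; sources supported in `Ω`) for the CONCRETE (Higgs)₂,₃ propagator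
# `G^ε_k(Ω, A) = HiggsCovariance.propagatorK C Ω A m² a k` of [Balaban1982Higgs1] (2.20) p. 610 with the `k`-fold covariant averaging
# (2.11): `|⟨g, G^ε_k(Ω,A)g′⟩| ≤ (2/γ₀)(L^kε)²e^{−δ·dist(supp g, supp g′)/L^k}‖g‖‖g′‖`, ONE `(δ₀, c₀)` for every `ε`, torus, `Ω`, `k`, `m²`
# AND EVERY `A` regular on `Ω` with `d²·ε|e|·L^{2k}·δ_A ≤ 1/3` — *"If Ω and A are as in Proposition I.2.1"*

statement-level skeleton of published theorems with citation tags; proofs where landed; nothing here is a claim about the Yang–Mills mass gap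

PDF held: `paper:balaban1983-cmp89-regularity-decay` (journal page = PDF page + 570), p. 580 [PDF 10] (2.30), p. 581 [PDF 11],
p. 572 [PDF 2] ((1.3), the torus), p. 573 [PDF 3] (1.8); [Balaban1982Higgs1] = `paper:balaban1982-cmp85-higgs23-i`, p. 610 [PDF 8]
(2.20), (2.23), p. 611 [PDF 9] Props. 2.2–2.3 (OCR `p0009.txt` re-read by this seat).

CITATION HEADER (lean-in-tree rule).  Cell `lit-balaban` (HOME `run/shared/lean/pub/lit-balaban/`), reader/typer seat **r14** gen 14
(unit `lit-balaban-r14`, B1 fold owner; TAKING line HOME/STATUS.md 2026-08-22T07:18:39Z, free-target protocol G.5-34(d)).  SKELETON rows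
**B1.Prop2.3** / **B1.Prop2.2** (the INPUT of (2.27)/(2.34) for the printed regions at `A ≠ 0`: [B1] p. 611 cites Prop. 2.1 / [13],
whose L² form is Cor. 2.3 — *"Finally Corollary 2.3 implies that the considered operator is short-ranged … (5.4)"* [13] p. 594) and
**B1.Eq2.20**; [B4] row B4.Cor2.3 is r01's (this file is a MODEL INSTANCE at a regular `A ≠ 0` on the (Higgs)₂,₃ carrier with the
composite contours (2.11) — r01's `B4Cor23RegionPairFam` is the single-staircase B4 carrier, of which this carrier is not a member).
ARCHITECTURE = r14 g9's `B1Cor23ZeroFieldRegion` (the one-step Combes–Thomas at `A = 0`), followed section by section with the two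
changes a non-zero `A` requires: the one-bond conjugation inequality is applied to the TRANSPORTED pair `(U(A_b)w(b₊), w(b₋))`
(unitarity `‖U(A_b)v‖ = ‖v‖`), and the `P_k(A)` form is the zero-field block double sum of the TRANSPORTED field `U(A(Γ^{(k)}_{y,x}))w(x)`.
USED BY NAME, never restated: r14 g14 `B1Ineq18RegularRegion.{coercive_covOpK_regular_region_uniform, gammaReg_pos}` ((1.8) at a regular
`A` for regions — the coercivity USED here), r14 g9 `B1Cor23ZeroFieldRegion.{exists_weight, tdist_le_of_blockIter_eq_real,
siteInner_expSmul_expNegSmul, siteInner_indicator_comm}`, `B1Ineq234Concrete.tdist_self`, `B1Ineq234LevelZero.{tdist_shift_le_one, tdist_comm}`,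
`B1Ineq233Upper.{sum_bond_src_sq, sum_bond_tgt_sq}`, `B1Eq353SupNorm.card_blockK`, `B2Ineq329ZeroAveraging.{mesh_pow_d, mesh_eq}`,
`B2Restr216Lattice.norm_U_apply`, the typer's `HiggsCovariancePos.{siteInner_covLaplacianN, siteInner_avgQkLin, covOpK_injective,
covOpK_propagatorK_apply, eq_zero_of_siteInner_self_eq_zero}`, `HiggsCovarianceCont.{sNorm, abs_siteInner_le}`.

WHAT IS PRINTED (verbatim, [13] p. 580 [PDF 10]): *"Corollary 2.3. If Ω and A are as in Proposition I.2.1, then there exist positive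
constants c₀, δ₀ such that for arbitrary scalar field configurations f, f′ defined on Ω, we have |⟨f, G_k(Ω,A)f′⟩|, |⟨f, D^η_{A,μ}G_k(Ω,A)f′⟩|,
|⟨f, G_k(Ω,A)D^{η*}_{A,ν}f′⟩|, |⟨f, D^η_{A,μ}G_k(Ω,A)D^{η*}_{A,ν}f′⟩| ≤ c₀e^{−δ₀dist(supp f, supp f′)}‖f‖₂‖f′‖₂. (2.30)"*; p. 581 [PDF 11]:
*"Let us notice also that now there are no restrictions on supports of f, f′, so in this aspect the Corollary is a little bit stronger
than Proposition I.2.1."*; [B1] p. 610 [PDF 8]: *"let a configuration A be regular on Ω in the sense that |(∂^η_μA)(x)| ≦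
c(e(L^kε))^{β−1}, x ∈ Ω, μ = 1, …, d, (2.23)"*.

DICTIONARY.  As in `B1Cor23ZeroFieldRegion` (torus distance (1.3) `Site.tdist` in lattice units; `Ω` a union of `k`-fold blocks, `hΩ`;
*"f, f′ defined on Ω"* ↦ `g′` SUPPORTED IN `Ω`, `g` arbitrary; `⟨·,·⟩`, `‖·‖₂` = (1.5) `siteInner`, `sNorm`); «A as in Proposition I.2.1» =
(2.23) ↦ the lattice regularity `|A ⟨z + εe_ν, μ⟩ − A ⟨z, μ⟩| ≦ δ_A`, `z ∈ Ω`, with `d²·ε|e|·L^{2k}·δ_A ≦ 1/3` (`B1Ineq18RegularRegion`; in the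
printed currency `d²·c·e(L^kε)^β ≦ 1/3`, §5).

WHAT THIS FILE PROVES (kernel-checked, zero `sorry`, theorems only; axioms standard).
* §0 (private) the elementary conjugation bounds of r14 g9 (`e^s + e^{−s} − 2 ≤ 2s²`, `|e^s − 1| ≤ e^τ − 1`, `e^δ − 1 ≤ 2δ`, the one-bond
  conjugation inequality `bond_conj_ge` in `ℝ^N`).
* §1 `covDeriv_expSmul` (the covariant derivative of `e^{ρ}w`: `ε^{−1}(e^{ρ(b₊)}U(A_b)w(b₊) − e^{ρ(b₋)}w(b₋))`).
* §2 the conjugated forms at a general `A`: **`lap_conj_ge`** (`⟨w,−Δ_{A,Ω}w⟩ − 2dσ²ε^{−2}‖w‖² ≤ ⟨e^{ρ}w, −Δ_{A,Ω}(e^{−ρ}w)⟩`, `|∂ρ| ≤ σ ≤ 1`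
  per bond — the transported pair `(U(A_b)w(b₊), w(b₋))`), **`siteInner_projPk_eq`** (`⟨φ, P_k(A)ψ⟩` as the block double sum of the
  transported fields), **`projPk_conj_ge`**, `siteInner_covOpK_eq`, **`covOpK_conj_ge`**.
* §3 support at a general `A`: `siteInner_covOpK_indicator` / `covOpK_indicator_comm` / `propagatorK_indicator_comm` /
  **`propagatorK_supported`** (`G^ε_k(Ω,A)` maps fields supported in `Ω` to fields supported in `Ω`).
* §4 **`sNorm_conj_propagatorK_le`** and **`pairing_of_coercive`** — Combes–Thomas from a coercivity constant, general `A`.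
* §5 with r14 g14's (1.8) at a regular `A`, `γ₀ = min{2, a(1 − L^{−2})/4}`: `delta_admissible`, **`propagatorK_pairing_regular_region`**
  (`1 ≤ k ≤ K`, `m² > 0`, `a > 0`, `L > 1`, `(4d + 4a)δ ≤ γ₀`, `A` regular on `Ω` with `d²·ε|e|·L^{2k}·δ_A ≤ 1/3`), `…_sep` (`L^kε ≤ 1`),
  **`cor23_first_regular_region`** (THE PRINTED QUANTIFIER SHAPE: `∃ δ₀ c₀ > 0` depending on `d, L, a` only, for every torus, every charge,
  every `m² > 0`, `1 ≤ k ≤ K` with `L^kε ≤ 1`, every block union `Ω`, EVERY `A` regular on `Ω` below the threshold, all `g`, `g′ ⊂ Ω`, `r`),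
  **`cor23_first_reg223_region`** (the same with the regularity in the printed (2.23) currency `d²·c·e(L^kε)^β ≤ 1/3`).
HONEST SCOPE / DIVERGENCE.  (i) FIRST of the four pairings only; (ii) `Ω` = any union of `k`-fold blocks of `T_ε`, weaker than *"unions
of big blocks"*; `g′` supported in `Ω` as printed, `g` arbitrary; regularity of `A` asked at the sites of `Ω` only; (iii) METHOD: one-step
Combes–Thomas conjugation, NOT the print's random-walk expansion over Lemma 2.1 — a disclosed divergence serving the printed STATEMENT;
constants explicit and crude (`c₀ = 2/γ₀`, `δ₀ = γ₀/(4d + 4a)`, `γ₀ = min{2, a(1 − L^{−2})/4}`); `m² > 0` needed only for the invertibility of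
(2.20) (the bound is uniform in `m²`); the smallness threshold `1/3` is `B1Ineq18RegularRegion`'s; (iv) nothing here is summit progress.
Downstream (same seat): (2.27) and (2.34)/(2.36) for the printed regions at a regular `A`.
-/

noncomputable section

open scoped BigOperators InnerProductSpace

namespace Literature.MathematicalPhysics.QuantumFieldTheory.Balaban1983to89.B1Cor23RegularRegion

open HiggsLattice HiggsAveraging HiggsCovariance HiggsCovariancePos
open HiggsCovarianceCont (sNorm sNorm_nonneg sNorm_sq abs_siteInner_le)
open HiggsFluctMeasurePos (siteInner_comm siteInner_add_right siteInner_smul_right siteInner_sub_right)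
open B2Ineq329ZeroAveraging (val_blockIter mesh_pow_d mesh_eq)
open B2Restr216Lattice (norm_U_apply)
open B1Eq353SupNorm (card_blockK)
open B1Ineq233Upper (sum_bond_src_sq sum_bond_tgt_sq)
open B1Ineq234Concrete (tdist_self)
open B1Ineq234LevelZero (tdist_shift_le_one tdist_comm tdist_triangle_real)
open B1Cor23ZeroFieldRegion (exists_weight tdist_le_of_blockIter_eq_real siteInner_expSmul_expNegSmul siteInner_indicator_comm)
open B1Ineq18RegularRegion (coercive_covOpK_regular_region_uniform gammaReg_pos coercive_covOpK_of_reg223)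

variable {P : HiggsLattice.Params} {N : ℕ} {k : ℕ}

/-! ## §0 Elementary bounds for the conjugation factors (as in r14 g9, private there) -/

section Elementary

/-- `e^s + e^{−s} − 2 ≤ 2s²` for `|s| ≤ 1` (from `|e^x − 1 − x| ≤ x²`). [folklore] -/
private theorem exp_add_exp_neg_sub_two_le {s : ℝ} (h : |s| ≤ 1) : Real.exp s + Real.exp (-s) - 2 ≤ 2 * s ^ 2 := by
  have h1 := Real.abs_exp_sub_one_sub_id_le h
  have h2 := Real.abs_exp_sub_one_sub_id_le (show |(-s)| ≤ 1 by rwa [abs_neg])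
  have e1 := (abs_le.mp h1).2
  have e2 := (abs_le.mp h2).2
  nlinarith

/-- `0 ≤ e^s + e^{−s} − 2`. [folklore] -/
private theorem exp_add_exp_neg_sub_two_nonneg (s : ℝ) : 0 ≤ Real.exp s + Real.exp (-s) - 2 := by
  have hprod : Real.exp s * Real.exp (-s) = 1 := by rw [← Real.exp_add, add_neg_cancel, Real.exp_zero]
  nlinarith [mul_nonneg (sq_nonneg (Real.exp s - 1)) (Real.exp_pos (-s)).le, Real.exp_pos s, Real.exp_pos (-s)]

/-- `|e^s − 1| ≤ e^τ − 1` for `|s| ≤ τ`. [folklore] -/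
private theorem abs_exp_sub_one_le {s τ : ℝ} (h : |s| ≤ τ) : |Real.exp s - 1| ≤ Real.exp τ - 1 := by
  have hs1 : s ≤ τ := (abs_le.mp h).2
  have hs2 : -τ ≤ s := (abs_le.mp h).1
  rw [abs_le]
  constructor
  · have h1 : Real.exp (-τ) ≤ Real.exp s := Real.exp_le_exp.mpr hs2
    have h2 := exp_add_exp_neg_sub_two_nonneg τ
    linarith
  · have h1 : Real.exp s ≤ Real.exp τ := Real.exp_le_exp.mpr hs1
    linarith

/-- `e^δ − 1 ≤ 2δ` for `0 ≤ δ ≤ 1`. [folklore] -/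
private theorem exp_sub_one_le_two_mul {δ : ℝ} (h0 : 0 ≤ δ) (h1 : δ ≤ 1) : Real.exp δ - 1 ≤ 2 * δ := by
  have h := Real.abs_exp_sub_one_sub_id_le (show |δ| ≤ 1 by rwa [abs_of_nonneg h0])
  have e := (abs_le.mp h).2
  nlinarith

/-- `⟪e^p a, e^{−q} b⟫ = e^{p−q}⟪a, b⟫`. [folklore] -/
private theorem inner_expSmul_expNegSmul (p q : ℝ) (a b : E N) :
    ⟪Real.exp p • a, Real.exp (-q) • b⟫_ℝ = Real.exp (p - q) * ⟪a, b⟫_ℝ := by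
  rw [real_inner_smul_left, real_inner_smul_right, ← mul_assoc, ← Real.exp_add, sub_eq_add_neg]

/-- **The one-bond conjugation inequality**: for `a, b ∈ ℝ^N` and `|p − q| ≤ 1`,
`|a − b|² − (p − q)²(|a|² + |b|²) ≤ ⟪e^p a − e^q b, e^{−p} a − e^{−q} b⟫`. [folklore] -/
private theorem bond_conj_ge (a b : E N) {p q : ℝ} (h : |p - q| ≤ 1) :
    ⟪a - b, a - b⟫_ℝ - (p - q) ^ 2 * (‖a‖ ^ 2 + ‖b‖ ^ 2)
      ≤ ⟪Real.exp p • a - Real.exp q • b, Real.exp (-p) • a - Real.exp (-q) • b⟫_ℝ := by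
  have hE := exp_add_exp_neg_sub_two_le h
  have hE0 := exp_add_exp_neg_sub_two_nonneg (p - q)
  rw [neg_sub] at hE hE0
  have hab : |⟪a, b⟫_ℝ| ≤ ‖a‖ * ‖b‖ := abs_real_inner_le_norm a b
  have hexp : ⟪Real.exp p • a - Real.exp q • b, Real.exp (-p) • a - Real.exp (-q) • b⟫_ℝ
      = ‖a‖ ^ 2 + ‖b‖ ^ 2 - (Real.exp (p - q) + Real.exp (q - p)) * ⟪a, b⟫_ℝ := by
    rw [inner_sub_left, inner_sub_right, inner_sub_right, inner_expSmul_expNegSmul, inner_expSmul_expNegSmul,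
      inner_expSmul_expNegSmul, inner_expSmul_expNegSmul, sub_self, sub_self, Real.exp_zero, one_mul, one_mul,
      real_inner_self_eq_norm_sq, real_inner_self_eq_norm_sq, real_inner_comm a b]
    ring
  have hplain : ⟪a - b, a - b⟫_ℝ = ‖a‖ ^ 2 + ‖b‖ ^ 2 - 2 * ⟪a, b⟫_ℝ := by
    rw [inner_sub_left, inner_sub_right, inner_sub_right, real_inner_self_eq_norm_sq, real_inner_self_eq_norm_sq,
      real_inner_comm a b]
    ring
  rw [hexp, hplain]
  have key : (Real.exp (p - q) + Real.exp (q - p) - 2) * ⟪a, b⟫_ℝ ≤ (p - q) ^ 2 * (‖a‖ ^ 2 + ‖b‖ ^ 2) := by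
    calc (Real.exp (p - q) + Real.exp (q - p) - 2) * ⟪a, b⟫_ℝ
        ≤ (Real.exp (p - q) + Real.exp (q - p) - 2) * |⟪a, b⟫_ℝ| :=
          mul_le_mul_of_nonneg_left (le_abs_self _) hE0
      _ ≤ (2 * (p - q) ^ 2) * (‖a‖ * ‖b‖) := mul_le_mul hE hab (abs_nonneg _) (by positivity)
      _ ≤ (p - q) ^ 2 * (‖a‖ ^ 2 + ‖b‖ ^ 2) := by nlinarith [sq_nonneg (p - q), sq_nonneg (‖a‖ - ‖b‖)]
  linarith

end Elementary

/-! ## §1 The covariant derivative of a conjugated field -/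

section CovDeriv

variable (C : ChargeData N)

/-- `(D^ε_A(e^{ρ}w))(b) = ε^{−1}(e^{ρ(b₊)}U(A_b)w(b₊) − e^{ρ(b₋)}w(b₋))` (`U(A_b)` is `ℝ`-linear). [cite: Balaban1982Higgs1, (1.7) p.605] -/
theorem covDeriv_expSmul (A : HiggsLattice.VecField P 0) (ρ : HiggsLattice.Site P 0 → ℝ) (w : ScalarField P 0 N)
    (b : HiggsLattice.PBond P 0) :
    covDeriv C A (fun x => Real.exp (ρ x) • w x) b
      = (P.mesh 0)⁻¹ • (Real.exp (ρ b.tgt) • C.U (P.mesh 0) (A b) (w b.tgt) - Real.exp (ρ b.src) • w b.src) := by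
  unfold HiggsLattice.covDeriv
  rw [ContinuousLinearMap.map_smul]

/-- `(D^ε_Aw)(b) = ε^{−1}(U(A_b)w(b₊) − w(b₋))` (unfolding). [cite: Balaban1982Higgs1, (1.7) p.605] -/
theorem covDeriv_eq (A : HiggsLattice.VecField P 0) (w : ScalarField P 0 N) (b : HiggsLattice.PBond P 0) :
    covDeriv C A w b = (P.mesh 0)⁻¹ • (C.U (P.mesh 0) (A b) (w b.tgt) - w b.src) := rfl

end CovDeriv

/-! ## §2 The conjugated forms at a general `A`: Neumann Laplacian, `P_k(A)`, the operator of (2.20) -/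

section Conjugation

variable (C : ChargeData N)

/-- **Conjugated covariant Neumann form** ([13] p. 572: the form `Σ_{b⊂Ω}η^d|D_Aφ(b)|²`), general `A`: for an exponent `ρ` with
`|ρ(b₊) − ρ(b₋)| ≤ σ ≤ 1` on every bond,
`⟨w, −Δ^{ε,N}_{A,Ω}w⟩ − 2dσ²ε^{−2}‖w‖² ≤ ⟨e^{ρ}w, −Δ^{ε,N}_{A,Ω}(e^{−ρ}w)⟩` — the one-bond inequality for the transported pair
`(U(A_b)w(b₊), w(b₋))`, `‖U(A_b)w(b₊)‖ = ‖w(b₊)‖`. [cite: Balaban1983RegularityDecay, (1.3) p.572; Cor. 2.3 (2.30) p.580] -/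
theorem lap_conj_ge (Ω : Finset (HiggsLattice.Site P 0)) (A : HiggsLattice.VecField P 0) (ρ : HiggsLattice.Site P 0 → ℝ)
    {σ : ℝ} (hσ : σ ≤ 1) (hρ : ∀ b : HiggsLattice.PBond P 0, |ρ b.tgt - ρ b.src| ≤ σ) (w : ScalarField P 0 N) :
    siteInner w (covLaplacianN C Ω A w)
        - 2 * P.d * σ ^ 2 * (P.mesh 0)⁻¹ ^ 2 * siteInner w w
      ≤ siteInner (fun x => Real.exp (ρ x) • w x)
          (covLaplacianN C Ω A (fun x => Real.exp (-ρ x) • w x)) := by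
  rw [siteInner_covLaplacianN, siteInner_covLaplacianN]
  have hterm : ∀ b : HiggsLattice.PBond P 0,
      (if Inside Ω b then P.mesh 0 ^ P.d * ⟪covDeriv C A w b, covDeriv C A w b⟫_ℝ else 0)
        - σ ^ 2 * (P.mesh 0)⁻¹ ^ 2 * (P.mesh 0 ^ P.d * ‖w b.tgt‖ ^ 2 + P.mesh 0 ^ P.d * ‖w b.src‖ ^ 2)
      ≤ (if Inside Ω b then P.mesh 0 ^ P.d *
          ⟪covDeriv C A (fun x => Real.exp (ρ x) • w x) b, covDeriv C A (fun x => Real.exp (-ρ x) • w x) b⟫_ℝ else 0) := by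
    intro b
    have hnn : 0 ≤ σ ^ 2 * (P.mesh 0)⁻¹ ^ 2 * (P.mesh 0 ^ P.d * ‖w b.tgt‖ ^ 2 + P.mesh 0 ^ P.d * ‖w b.src‖ ^ 2) := by
      have := P.mesh_pos 0
      positivity
    split_ifs with hb
    · rw [covDeriv_expSmul, covDeriv_expSmul, covDeriv_eq]
      simp only [real_inner_smul_left, real_inner_smul_right]
      set a : E N := C.U (P.mesh 0) (A b) (w b.tgt) with ha
      have hna : ‖a‖ = ‖w b.tgt‖ := norm_U_apply C _ _ _
      have hpq : |ρ b.tgt - ρ b.src| ≤ 1 := (hρ b).trans hσ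
      have hbd := bond_conj_ge a (w b.src) hpq
      rw [hna] at hbd
      have hsq : (ρ b.tgt - ρ b.src) ^ 2 ≤ σ ^ 2 := by
        rw [← sq_abs]
        exact pow_le_pow_left₀ (abs_nonneg _) (hρ b) 2
      have hA : 0 ≤ P.mesh 0 ^ P.d * ((P.mesh 0)⁻¹ * (P.mesh 0)⁻¹) := by
        have := P.mesh_pos 0
        positivity
      have hS : 0 ≤ ‖w b.tgt‖ ^ 2 + ‖w b.src‖ ^ 2 := by positivity
      have h1 := mul_le_mul_of_nonneg_left hbd hA
      have h2 : (ρ b.tgt - ρ b.src) ^ 2 * (‖w b.tgt‖ ^ 2 + ‖w b.src‖ ^ 2) ≤ σ ^ 2 * (‖w b.tgt‖ ^ 2 + ‖w b.src‖ ^ 2) :=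
        mul_le_mul_of_nonneg_right hsq hS
      have h3 := mul_le_mul_of_nonneg_left h2 hA
      have hid : (P.mesh 0)⁻¹ ^ 2 = (P.mesh 0)⁻¹ * (P.mesh 0)⁻¹ := sq _
      rw [hid]
      nlinarith [h1, h3]
    · linarith
  have hsum := Finset.sum_le_sum fun b (_ : b ∈ (Finset.univ : Finset (HiggsLattice.PBond P 0))) => hterm b
  rw [Finset.sum_sub_distrib, ← Finset.mul_sum, Finset.sum_add_distrib, sum_bond_tgt_sq, sum_bond_src_sq] at hsum
  linarith

/-- **`⟨φ, P_k(A)ψ⟩ = Σ_y (L^kε)^d L^{−2kd} Σ_{x,x′∈B^k(y)} ⟪U(A(Γ^{(k)}_{y,x}))φ(x), U(A(Γ^{(k)}_{y,x′}))ψ(x′)⟫`** (`P_k(A) = Q_k^*(A)Q_k(A)`,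
`Q_k(A)` the covariant block mean (2.11)). [cite: Balaban1982Higgs1, (2.11) p.609; (2.20) p.610] -/
theorem siteInner_projPk_eq (A : HiggsLattice.VecField P 0) (k : ℕ) (φ ψ : ScalarField P 0 N) :
    siteInner φ (projPk C A k ψ)
      = ∑ y : HiggsLattice.Site P k, P.mesh k ^ P.d * ((((P.L : ℝ) ^ (k * P.d))⁻¹) ^ 2 *
          ∑ x ∈ blockK k y, ∑ x' ∈ blockK k y,
            ⟪C.U (P.mesh 0) (multiContourSum A k x) (φ x), C.U (P.mesh 0) (multiContourSum A k x') (ψ x')⟫_ℝ) := by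
  unfold projPk
  rw [LinearMap.comp_apply, ← siteInner_avgQkLin, siteInner]
  refine Finset.sum_congr rfl fun y _ => ?_
  rw [avgQkLin_apply, avgQkLin_apply, avgQk_apply, avgQk_apply, real_inner_smul_left, real_inner_smul_right, sum_inner]
  simp_rw [inner_sum]
  ring

/-- **Conjugated covariant averaging form**: for an exponent `ρ` with `|ρ(x) − ρ(x′)| ≤ τ₀` whenever `x, x′` lie in one `k`-fold block,
`⟨w, P_k(A)w⟩ − (e^{τ₀} − 1)‖w‖² ≤ ⟨e^{ρ}w, P_k(A)(e^{−ρ}w)⟩` (`k ≤ K`; Cauchy–Schwarz on each block for the transported field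
`U(A(Γ^{(k)}_{y,x}))w(x)`, unitarity). [cite: Balaban1982Higgs1, (2.20) p.610] -/
theorem projPk_conj_ge (hk : k ≤ P.K) (A : HiggsLattice.VecField P 0) (ρ : HiggsLattice.Site P 0 → ℝ) {τ₀ : ℝ}
    (hτ : ∀ x x' : HiggsLattice.Site P 0, blockIter k x = blockIter k x' → |ρ x - ρ x'| ≤ τ₀) (w : ScalarField P 0 N) :
    siteInner w (projPk C A k w) - (Real.exp τ₀ - 1) * siteInner w w
      ≤ siteInner (fun x => Real.exp (ρ x) • w x)
          (projPk C A k (fun x => Real.exp (-ρ x) • w x)) := by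
  rw [siteInner_projPk_eq, siteInner_projPk_eq]
  -- the transported field
  set v : ScalarField P 0 N := fun x => C.U (P.mesh 0) (multiContourSum A k x) (w x) with hv
  have hvn : ∀ x, ‖v x‖ = ‖w x‖ := fun x => norm_U_apply C _ _ _
  have htr : ∀ x, C.U (P.mesh 0) (multiContourSum A k x) (Real.exp (ρ x) • w x) = Real.exp (ρ x) • v x := fun x => by
    rw [ContinuousLinearMap.map_smul]
  have htr' : ∀ x, C.U (P.mesh 0) (multiContourSum A k x) (Real.exp (-ρ x) • w x) = Real.exp (-ρ x) • v x := fun x => by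
    rw [ContinuousLinearMap.map_smul]
  simp_rw [htr, htr']
  set τ := Real.exp τ₀ - 1 with hτdef
  have hτ0 : 0 ≤ τ₀ := by
    have h := hτ (fun _ => 0) (fun _ => 0) rfl
    rw [sub_self, abs_zero] at h
    exact h
  have hτnn : 0 ≤ τ := by
    rw [hτdef]
    have : 1 ≤ Real.exp τ₀ := Real.one_le_exp hτ0
    linarith
  have hblock : ∀ y : HiggsLattice.Site P k,
      (∑ x ∈ blockK k y, ∑ x' ∈ blockK k y, ⟪v x, v x'⟫_ℝ)
          - τ * ((P.L : ℝ) ^ (k * P.d) * ∑ x ∈ blockK k y, ‖w x‖ ^ 2)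
        ≤ ∑ x ∈ blockK k y, ∑ x' ∈ blockK k y, ⟪Real.exp (ρ x) • v x, Real.exp (-ρ x') • v x'⟫_ℝ := by
    intro y
    have hpt : ∀ x ∈ blockK k y, ∀ x' ∈ blockK k y,
        ⟪v x, v x'⟫_ℝ - τ * (‖w x‖ * ‖w x'‖) ≤ ⟪Real.exp (ρ x) • v x, Real.exp (-ρ x') • v x'⟫_ℝ := by
      intro x hx x' hx'
      rw [inner_expSmul_expNegSmul]
      have hxx' : blockIter k x = blockIter k x' := by rw [(mem_blockK k y x).mp hx, (mem_blockK k y x').mp hx']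
      have he : |Real.exp (ρ x - ρ x') - 1| ≤ τ := abs_exp_sub_one_le (hτ x x' hxx')
      have hin : |⟪v x, v x'⟫_ℝ| ≤ ‖w x‖ * ‖w x'‖ := by
        rw [← hvn x, ← hvn x']; exact abs_real_inner_le_norm _ _
      have h3 : |(Real.exp (ρ x - ρ x') - 1) * ⟪v x, v x'⟫_ℝ| ≤ τ * (‖w x‖ * ‖w x'‖) := by
        rw [abs_mul]
        exact mul_le_mul he hin (abs_nonneg _) hτnn
      have h4 := neg_abs_le ((Real.exp (ρ x - ρ x') - 1) * ⟪v x, v x'⟫_ℝ)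
      nlinarith
    have hs := Finset.sum_le_sum fun x hx => Finset.sum_le_sum fun x' hx' => hpt x hx x' hx'
    have hcs : (∑ x ∈ blockK k y, ‖w x‖) ^ 2 ≤ (blockK k y).card * ∑ x ∈ blockK k y, ‖w x‖ ^ 2 :=
      sq_sum_le_card_mul_sum_sq
    rw [card_blockK hk] at hcs
    push_cast at hcs
    have hre : ∑ x ∈ blockK k y, ∑ x' ∈ blockK k y, (⟪v x, v x'⟫_ℝ - τ * (‖w x‖ * ‖w x'‖))
        = (∑ x ∈ blockK k y, ∑ x' ∈ blockK k y, ⟪v x, v x'⟫_ℝ) - τ * (∑ x ∈ blockK k y, ‖w x‖) ^ 2 := by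
      rw [sq, Finset.sum_mul_sum, Finset.mul_sum, ← Finset.sum_sub_distrib]
      refine Finset.sum_congr rfl fun x _ => ?_
      rw [Finset.mul_sum, ← Finset.sum_sub_distrib]
    rw [hre] at hs
    nlinarith [mul_le_mul_of_nonneg_left hcs hτnn]
  have hL : (0 : ℝ) < (P.L : ℝ) ^ (k * P.d) := pow_pos (by exact_mod_cast P.hL) _
  have hcoef : P.mesh k ^ P.d * (((P.L : ℝ) ^ (k * P.d))⁻¹) ^ 2 * (P.L : ℝ) ^ (k * P.d) = P.mesh 0 ^ P.d := by
    rw [mesh_pow_d]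
    field_simp
  have hnorm : ∑ y : HiggsLattice.Site P k, P.mesh k ^ P.d * (((P.L : ℝ) ^ (k * P.d))⁻¹) ^ 2 *
      ((P.L : ℝ) ^ (k * P.d) * ∑ x ∈ blockK k y, ‖w x‖ ^ 2) = siteInner w w := by
    rw [siteInner_self_eq, ← Finset.sum_fiberwise_of_maps_to (s := Finset.univ) (t := Finset.univ)
      (g := fun x : HiggsLattice.Site P 0 => blockIter k x) (fun _ _ => Finset.mem_univ _)]
    refine Finset.sum_congr rfl fun y _ => ?_
    rw [← mul_assoc, hcoef, Finset.mul_sum]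
    rfl
  have hsum := Finset.sum_le_sum fun y (_ : y ∈ (Finset.univ : Finset (HiggsLattice.Site P k))) =>
    mul_le_mul_of_nonneg_left (hblock y) (show 0 ≤ P.mesh k ^ P.d * (((P.L : ℝ) ^ (k * P.d))⁻¹) ^ 2 by
      have := P.mesh_pos k
      positivity)
  have hsplit : ∑ y : HiggsLattice.Site P k, P.mesh k ^ P.d * (((P.L : ℝ) ^ (k * P.d))⁻¹) ^ 2 *
      ((∑ x ∈ blockK k y, ∑ x' ∈ blockK k y, ⟪v x, v x'⟫_ℝ)
        - τ * ((P.L : ℝ) ^ (k * P.d) * ∑ x ∈ blockK k y, ‖w x‖ ^ 2))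
      = (∑ y : HiggsLattice.Site P k, P.mesh k ^ P.d * ((((P.L : ℝ) ^ (k * P.d))⁻¹) ^ 2 *
          ∑ x ∈ blockK k y, ∑ x' ∈ blockK k y, ⟪v x, v x'⟫_ℝ)) - τ * siteInner w w := by
    rw [← hnorm, Finset.mul_sum, ← Finset.sum_sub_distrib]
    refine Finset.sum_congr rfl fun y _ => ?_
    ring
  rw [hsplit] at hsum
  refine hsum.trans (le_of_eq (Finset.sum_congr rfl fun y _ => by ring))

/-- **The form of (2.20) at a general `A`, expanded**: `⟨φ, (−Δ^{ε,N}_{A,Ω} + m² + a_k(L^kε)^{−2}P_k(A))ψ⟩ =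
Σ_{b⊂Ω}ε^d⟪D_Aφ(b), D_Aψ(b)⟫ + m²⟨φ, ψ⟩ + a_k(L^kε)^{−2}·[the transported block double sum]`. [cite: Balaban1982Higgs1, (2.20) p.610] -/
theorem siteInner_covOpK_eq (Ω : Finset (HiggsLattice.Site P 0)) (A : HiggsLattice.VecField P 0) (msq a : ℝ) (k : ℕ)
    (φ ψ : ScalarField P 0 N) :
    siteInner φ (covOpK C Ω A msq a k ψ)
      = (∑ b : HiggsLattice.PBond P 0, (if Inside Ω b then P.mesh 0 ^ P.d * ⟪covDeriv C A φ b, covDeriv C A ψ b⟫_ℝ else 0))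
        + msq * siteInner φ ψ
        + B1.aSeq a P.L k * ((P.mesh k)⁻¹ ^ 2) *
          ∑ y : HiggsLattice.Site P k, P.mesh k ^ P.d * ((((P.L : ℝ) ^ (k * P.d))⁻¹) ^ 2 *
            ∑ x ∈ blockK k y, ∑ x' ∈ blockK k y,
              ⟪C.U (P.mesh 0) (multiContourSum A k x) (φ x), C.U (P.mesh 0) (multiContourSum A k x') (ψ x')⟫_ℝ) := by
  rw [covOpK, LinearMap.add_apply, LinearMap.add_apply, LinearMap.smul_apply, LinearMap.smul_apply,
    LinearMap.id_apply, siteInner_add_right, siteInner_add_right, siteInner_smul_right, siteInner_smul_right,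
    siteInner_covLaplacianN, siteInner_projPk_eq]

/-- **The conjugated operator form at a general `A`**: for an exponent `ρ` with `|ρ(b₊) − ρ(b₋)| ≤ σ ≤ 1` on bonds and
`|ρ(x) − ρ(x′)| ≤ τ₀` inside `k`-fold blocks (`k ≤ K`, `a_k ≥ 0`),
`⟨w, Hw⟩ − (2dσ²ε^{−2} + a_k(L^kε)^{−2}(e^{τ₀} − 1))‖w‖² ≤ ⟨e^{ρ}w, H(e^{−ρ}w)⟩`, `H = −Δ^{ε,N}_{A,Ω} + m² + a_k(L^kε)^{−2}P_k(A)`.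
[cite: Balaban1983RegularityDecay, Cor. 2.3 (2.30) p.580] -/
theorem covOpK_conj_ge (hk : k ≤ P.K) (Ω : Finset (HiggsLattice.Site P 0)) (A : HiggsLattice.VecField P 0) (msq : ℝ) {a : ℝ}
    (hak : 0 ≤ B1.aSeq a P.L k) (ρ : HiggsLattice.Site P 0 → ℝ) {σ τ₀ : ℝ} (hσ : σ ≤ 1)
    (hρ : ∀ b : HiggsLattice.PBond P 0, |ρ b.tgt - ρ b.src| ≤ σ)
    (hτ : ∀ x x' : HiggsLattice.Site P 0, blockIter k x = blockIter k x' → |ρ x - ρ x'| ≤ τ₀) (w : ScalarField P 0 N) :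
    siteInner w (covOpK C Ω A msq a k w)
        - (2 * P.d * σ ^ 2 * (P.mesh 0)⁻¹ ^ 2 + B1.aSeq a P.L k * ((P.mesh k)⁻¹ ^ 2) * (Real.exp τ₀ - 1))
          * siteInner w w
      ≤ siteInner (fun x => Real.exp (ρ x) • w x)
          (covOpK C Ω A msq a k (fun x => Real.exp (-ρ x) • w x)) := by
  have h1 := lap_conj_ge C Ω A ρ hσ hρ w
  have h2 := projPk_conj_ge C hk A ρ hτ w
  have h3 := siteInner_expSmul_expNegSmul ρ w w
  rw [covOpK]
  simp only [LinearMap.add_apply, LinearMap.smul_apply, LinearMap.id_apply, siteInner_add_right, siteInner_smul_right]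
  rw [h3]
  have hc : 0 ≤ B1.aSeq a P.L k * ((P.mesh k)⁻¹ ^ 2) := mul_nonneg hak (sq_nonneg _)
  nlinarith [mul_le_mul_of_nonneg_left h2 hc]

end Conjugation

/-! ## §3 `G^ε_k(Ω, A)` preserves the fields supported in `Ω` (Ω a union of `k`-fold blocks), general `A` -/

section Support

variable (C : ChargeData N) (Ω : Finset (HiggsLattice.Site P 0)) (A : HiggsLattice.VecField P 0) {msq a : ℝ}

/-- **`H` commutes with the restriction to `Ω` in the form sense**, general `A`: `⟨φ, H(1_Ωψ)⟩ = ⟨1_Ωφ, Hψ⟩` for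
`H = −Δ^{ε,N}_{A,Ω} + m² + a_k(L^kε)^{−2}P_k(A)` and `Ω` a union of `k`-fold blocks (Neumann bonds lie inside `Ω`; `P_k(A)` is
block-diagonal). [cite: Balaban1982Higgs1, (2.20) p.610] -/
theorem siteInner_covOpK_indicator
    (hΩ : ∀ x x' : HiggsLattice.Site P 0, blockIter k x = blockIter k x' → (x ∈ Ω ↔ x' ∈ Ω)) (φ ψ : ScalarField P 0 N) :
    siteInner φ (covOpK C Ω A msq a k (fun x => if x ∈ Ω then ψ x else 0))
      = siteInner (fun x => if x ∈ Ω then φ x else 0) (covOpK C Ω A msq a k ψ) := by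
  rw [siteInner_covOpK_eq, siteInner_covOpK_eq, siteInner_indicator_comm]
  congr 2
  · refine Finset.sum_congr rfl fun b _ => ?_
    split_ifs with hb
    · rw [covDeriv_eq, covDeriv_eq, covDeriv_eq, covDeriv_eq]
      simp only [if_pos hb.1, if_pos hb.2]
    · rfl
  · refine Finset.sum_congr rfl fun y _ => ?_
    congr 2
    refine Finset.sum_congr rfl fun x hx => Finset.sum_congr rfl fun x' hx' => ?_
    have hiff : x ∈ Ω ↔ x' ∈ Ω := hΩ x x' (by rw [(mem_blockK k y x).mp hx, (mem_blockK k y x').mp hx'])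
    by_cases h : x ∈ Ω
    · rw [if_pos h, if_pos (hiff.mp h)]
    · rw [if_neg h, if_neg (fun h' => h (hiff.mpr h'))]
      simp

/-- **`H(1_Ωψ) = 1_Ω(Hψ)`**, general `A` (operator form, by non-degeneracy of (1.5)). [cite: Balaban1982Higgs1, (2.20) p.610] -/
theorem covOpK_indicator_comm
    (hΩ : ∀ x x' : HiggsLattice.Site P 0, blockIter k x = blockIter k x' → (x ∈ Ω ↔ x' ∈ Ω)) (ψ : ScalarField P 0 N) :
    covOpK C Ω A msq a k (fun x => if x ∈ Ω then ψ x else 0)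
      = fun x => if x ∈ Ω then covOpK C Ω A msq a k ψ x else 0 := by
  set d := covOpK C Ω A msq a k (fun x => if x ∈ Ω then ψ x else 0)
    - (fun x => if x ∈ Ω then covOpK C Ω A msq a k ψ x else 0) with hd
  have hzero : ∀ φ : ScalarField P 0 N, siteInner φ d = 0 := by
    intro φ
    rw [hd, siteInner_sub_right, siteInner_covOpK_indicator C Ω A hΩ, siteInner_indicator_comm, sub_self]
  have h0 : d = 0 := eq_zero_of_siteInner_self_eq_zero d (hzero d)
  rw [hd] at h0
  exact sub_eq_zero.mp h0

/-- **`G^ε_k(Ω,A)(1_Ωg) = 1_Ω(G^ε_k(Ω,A)g)`** (`m² > 0`, `a_k ≥ 0`, `Ω` a union of `k`-fold blocks), general `A`.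
[cite: Balaban1982Higgs1, (2.20) p.610] -/
theorem propagatorK_indicator_comm (hmsq : 0 < msq) (hak : 0 ≤ B1.aSeq a P.L k)
    (hΩ : ∀ x x' : HiggsLattice.Site P 0, blockIter k x = blockIter k x' → (x ∈ Ω ↔ x' ∈ Ω)) (g : ScalarField P 0 N) :
    propagatorK C Ω A msq a k (fun x => if x ∈ Ω then g x else 0)
      = fun x => if x ∈ Ω then propagatorK C Ω A msq a k g x else 0 := by
  apply covOpK_injective C Ω A hmsq a k hak
  rw [covOpK_propagatorK_apply C Ω _ hmsq a k hak, covOpK_indicator_comm C Ω A hΩ,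
    covOpK_propagatorK_apply C Ω _ hmsq a k hak]

/-- **`G^ε_k(Ω, A)` maps fields supported in `Ω` to fields supported in `Ω`**, general `A` — on the torus carrier the operator of
(2.20) is block-diagonal for `T_ε = Ω ⊔ Ωᶜ`, and its `Ω`-block is the printed operator *"on functions φ : Ω → R^N"*.
[cite: Balaban1982Higgs1, (2.20) p.610] -/
theorem propagatorK_supported (hmsq : 0 < msq) (hak : 0 ≤ B1.aSeq a P.L k)
    (hΩ : ∀ x x' : HiggsLattice.Site P 0, blockIter k x = blockIter k x' → (x ∈ Ω ↔ x' ∈ Ω))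
    (g : ScalarField P 0 N) (hg : ∀ x, x ∉ Ω → g x = 0) :
    ∀ x, x ∉ Ω → propagatorK C Ω A msq a k g x = 0 := by
  intro x hx
  have hPi : (fun x => if x ∈ Ω then g x else 0) = g := by
    funext x'
    split_ifs with h
    · rfl
    · exact (hg x' h).symm
  have hc := propagatorK_indicator_comm C Ω A hmsq hak hΩ g
  rw [hPi] at hc
  have hcx := congrFun hc x
  rw [hcx]
  exact if_neg hx

end Support

/-! ## §4 The Combes–Thomas bound for the first pairing, from a coercivity constant, general `A` -/

section Pairing

variable (C : ChargeData N) (A : HiggsLattice.VecField P 0) {msq a : ℝ}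

/-- **The Combes–Thomas norm bound at a general `A`**: for `Ω` a union of `k`-fold blocks (`k ≤ K`), `m² > 0`, `a_k ≥ 0`, a coercivity
constant `γ` (`γ(L^kε)^{−2}‖w‖² ≤ ⟨w, Hw⟩` for `w` supported in `Ω`), an exponent `ρ` with `|ρ(b₊) − ρ(b₋)| ≤ δ/L^k` on bonds,
`|ρ(x) − ρ(x′)| ≤ δ` inside `k`-fold blocks and `ρ = 0` on `supp g′` (`g′` supported in `Ω`), and the error budget `2(2dδ² + 2a_kδ) ≤ γ`
(`0 ≤ δ ≤ 1`): `‖e^{ρ}G^ε_k(Ω,A)g′‖ ≤ (2/γ)(L^kε)²‖g′‖`. [cite: Balaban1983RegularityDecay, Cor. 2.3 (2.30) p.580] -/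
theorem sNorm_conj_propagatorK_le (hk : k ≤ P.K) (Ω : Finset (HiggsLattice.Site P 0))
    (hΩ : ∀ x x' : HiggsLattice.Site P 0, blockIter k x = blockIter k x' → (x ∈ Ω ↔ x' ∈ Ω))
    (hmsq : 0 < msq) (hak : 0 ≤ B1.aSeq a P.L k) {γ : ℝ} (hγ : 0 < γ)
    (hlow : ∀ w : ScalarField P 0 N, (∀ x, x ∉ Ω → w x = 0) →
      γ * ((P.mesh k)⁻¹ ^ 2) * siteInner w w ≤ siteInner w (covOpK C Ω A msq a k w))
    {δ : ℝ} (hδ0 : 0 ≤ δ) (hδ1 : δ ≤ 1) (hδ : 2 * (2 * P.d * δ ^ 2 + B1.aSeq a P.L k * (2 * δ)) ≤ γ)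
    (ρ : HiggsLattice.Site P 0 → ℝ) (hρbond : ∀ b : HiggsLattice.PBond P 0, |ρ b.tgt - ρ b.src| ≤ δ / (P.L : ℝ) ^ k)
    (hρblock : ∀ x x' : HiggsLattice.Site P 0, blockIter k x = blockIter k x' → |ρ x - ρ x'| ≤ δ)
    (g' : ScalarField P 0 N) (hg' : ∀ x, x ∉ Ω → g' x = 0) (hρg' : ∀ x, g' x ≠ 0 → ρ x = 0) :
    sNorm (fun x => Real.exp (ρ x) • propagatorK C Ω A msq a k g' x)
      ≤ 2 / γ * P.mesh k ^ 2 * sNorm g' := by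
  have hM : 0 < P.mesh k := P.mesh_pos k
  have hLk : (1 : ℝ) ≤ (P.L : ℝ) ^ k := by exact_mod_cast Nat.one_le_pow _ _ P.hL
  have hLpos : (0 : ℝ) < (P.L : ℝ) ^ k := by linarith
  have hσ1 : δ / (P.L : ℝ) ^ k ≤ 1 := by
    rw [div_le_one hLpos]
    exact hδ1.trans hLk
  obtain ⟨u, hu⟩ : ∃ u : ScalarField P 0 N, u = propagatorK C Ω A msq a k g' := ⟨_, rfl⟩
  obtain ⟨w, hw⟩ : ∃ w : ScalarField P 0 N, w = fun x => Real.exp (ρ x) • u x := ⟨_, rfl⟩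
  have husupp : ∀ x, x ∉ Ω → u x = 0 := by
    rw [hu]
    exact propagatorK_supported C Ω A hmsq hak hΩ g' hg'
  have hwsupp : ∀ x, x ∉ Ω → w x = 0 := fun x hx => by rw [hw]; simp [husupp x hx]
  have hu_eq : (fun x => Real.exp (-ρ x) • w x) = u := by
    funext x
    rw [hw]
    simp only [smul_smul, ← Real.exp_add, neg_add_cancel, Real.exp_zero, one_smul]
  -- the conjugated form equals ⟨w, g'⟩
  have hS_eq : siteInner (fun x => Real.exp (ρ x) • w x)
      (covOpK C Ω A msq a k (fun x => Real.exp (-ρ x) • w x)) = siteInner w g' := by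
    rw [hu_eq, hu, covOpK_propagatorK_apply C Ω _ hmsq a k hak]
    unfold siteInner
    refine Finset.sum_congr rfl fun x _ => ?_
    by_cases hx : g' x = 0
    · simp [hx]
    · simp only [hρg' x hx, Real.exp_zero, one_smul]
  -- lower bound for the conjugated form, coercivity, Cauchy–Schwarz
  have hS_ge := covOpK_conj_ge C hk Ω A msq hak ρ hσ1 hρbond hρblock w
  rw [hS_eq] at hS_ge
  have hloww := hlow w hwsupp
  have hCS : siteInner w g' ≤ sNorm w * sNorm g' := (le_abs_self _).trans (abs_siteInner_le w g')
  -- the error budget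
  have hmesh : P.mesh k = (P.L : ℝ) ^ k * P.mesh 0 := mesh_eq k
  have hm0 : 0 < P.mesh 0 := P.mesh_pos 0
  have herr1 : 2 * P.d * (δ / (P.L : ℝ) ^ k) ^ 2 * (P.mesh 0)⁻¹ ^ 2 = 2 * P.d * δ ^ 2 * (P.mesh k)⁻¹ ^ 2 := by
    rw [hmesh]
    field_simp
  have herr2 : Real.exp δ - 1 ≤ 2 * δ := exp_sub_one_le_two_mul hδ0 hδ1
  have hMi : 0 < (P.mesh k)⁻¹ ^ 2 := by positivity
  have hww : 0 ≤ siteInner w w := siteInner_self_nonneg w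
  have herr : (2 * P.d * (δ / (P.L : ℝ) ^ k) ^ 2 * (P.mesh 0)⁻¹ ^ 2
      + B1.aSeq a P.L k * ((P.mesh k)⁻¹ ^ 2) * (Real.exp δ - 1)) * siteInner w w
        ≤ γ / 2 * (P.mesh k)⁻¹ ^ 2 * siteInner w w := by
    rw [herr1]
    refine mul_le_mul_of_nonneg_right ?_ hww
    have h1 : B1.aSeq a P.L k * ((P.mesh k)⁻¹ ^ 2) * (Real.exp δ - 1)
        ≤ B1.aSeq a P.L k * ((P.mesh k)⁻¹ ^ 2) * (2 * δ) :=
      mul_le_mul_of_nonneg_left herr2 (mul_nonneg hak hMi.le)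
    have h2 := mul_le_mul_of_nonneg_right hδ hMi.le
    linarith only [h1, h2]
  have hkey : γ / 2 * (P.mesh k)⁻¹ ^ 2 * siteInner w w ≤ sNorm w * sNorm g' := by
    linarith only [hS_ge, hloww, hCS, herr]
  -- so ‖w‖ ≤ (2/γ)(L^kε)²‖g'‖
  have hsw := sNorm_nonneg w
  have hsg := sNorm_nonneg g'
  have hgoal : w = fun x => Real.exp (ρ x) • propagatorK C Ω A msq a k g' x := by
    rw [hw, hu]
  rw [← hgoal]
  rw [← sNorm_sq] at hkey
  by_cases h0 : sNorm w = 0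
  · rw [h0]; positivity
  · have hpos : 0 < sNorm w := lt_of_le_of_ne hsw (Ne.symm h0)
    have h1 : γ / 2 * (P.mesh k)⁻¹ ^ 2 * sNorm w ≤ sNorm g' := by
      by_contra hcon
      have := mul_lt_mul_of_pos_right (not_le.mp hcon) hpos
      nlinarith only [this, hkey]
    have h2 : sNorm w = 2 / γ * P.mesh k ^ 2 * (γ / 2 * (P.mesh k)⁻¹ ^ 2 * sNorm w) := by
      field_simp
    rw [h2]
    exact mul_le_mul_of_nonneg_left h1 (by positivity)

/-- **Combes–Thomas for `G^ε_k(Ω, A)` on a union of `k`-fold blocks `Ω ⊂ T_ε`, FROM A COERCIVITY CONSTANT `γ`**, general `A` (`k ≤ K`,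
`m² > 0`, `a_k ≥ 0`): if `γ(L^kε)^{−2}‖w‖² ≤ ⟨w, Hw⟩` for all `w` supported in `Ω` and `0 ≤ δ ≤ 1` satisfies the error budget
`2(2dδ² + 2a_kδ) ≤ γ`, then for EVERY `g`, every `g′` supported in `Ω` and every `r` with `r ≤ |x − x′|` on `supp g × supp g′`:
`|⟨g, G^ε_k(Ω,A)g′⟩| ≤ (2/γ)(L^kε)²e^{−δr/L^k}‖g‖‖g′‖`. [cite: Balaban1983RegularityDecay, Cor. 2.3 (2.30) p.580] -/
theorem pairing_of_coercive (hk : k ≤ P.K) (Ω : Finset (HiggsLattice.Site P 0))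
    (hΩ : ∀ x x' : HiggsLattice.Site P 0, blockIter k x = blockIter k x' → (x ∈ Ω ↔ x' ∈ Ω))
    (hmsq : 0 < msq) (hak : 0 ≤ B1.aSeq a P.L k) {γ : ℝ} (hγ : 0 < γ)
    (hlow : ∀ w : ScalarField P 0 N, (∀ x, x ∉ Ω → w x = 0) →
      γ * ((P.mesh k)⁻¹ ^ 2) * siteInner w w ≤ siteInner w (covOpK C Ω A msq a k w))
    {δ : ℝ} (hδ0 : 0 ≤ δ) (hδ1 : δ ≤ 1) (hδ : 2 * (2 * P.d * δ ^ 2 + B1.aSeq a P.L k * (2 * δ)) ≤ γ)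
    (g g' : ScalarField P 0 N) (hg' : ∀ x, x ∉ Ω → g' x = 0) (r : ℝ)
    (hsep : ∀ x x', g x ≠ 0 → g' x' ≠ 0 → r ≤ (HiggsLattice.Site.tdist x x' : ℝ)) :
    |siteInner g (propagatorK C Ω A msq a k g')| ≤
      2 / γ * P.mesh k ^ 2 * Real.exp (-(δ * (r / (P.L : ℝ) ^ k))) *
        Real.sqrt (siteInner g g) * Real.sqrt (siteInner g' g') := by
  classical
  have hM : 0 < P.mesh k := P.mesh_pos k
  have hLk : (1 : ℝ) ≤ (P.L : ℝ) ^ k := by exact_mod_cast Nat.one_le_pow _ _ P.hL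
  have hLpos : (0 : ℝ) < (P.L : ℝ) ^ k := by linarith
  set T := Finset.univ.filter (fun x => g' x ≠ 0) with hT
  by_cases hTne : T.Nonempty
  swap
  · have hg0' : ∀ x, g' x = 0 := fun x => by
      by_contra h
      exact hTne ⟨x, Finset.mem_filter.mpr ⟨Finset.mem_univ _, h⟩⟩
    have hg0 : g' = 0 := funext hg0'
    rw [hg0, map_zero]
    have : siteInner g (0 : ScalarField P 0 N) = 0 := by simp [siteInner]
    rw [this, abs_zero]
    positivity
  obtain ⟨D, hDlip, hDzero, -, hDfar⟩ := exists_weight hTne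
  -- the exponent ρ = (δ/L^k)·dist(·, supp g')
  obtain ⟨ρ, hρ⟩ : ∃ ρ : HiggsLattice.Site P 0 → ℝ, ρ = fun x => δ / (P.L : ℝ) ^ k * D x := ⟨_, rfl⟩
  have hcoef : 0 ≤ δ / (P.L : ℝ) ^ k := div_nonneg hδ0 hLpos.le
  have hρsub : ∀ x z, ρ x - ρ z = δ / (P.L : ℝ) ^ k * (D x - D z) := fun x z => by rw [hρ]; ring
  have hρbond : ∀ b : HiggsLattice.PBond P 0, |ρ b.tgt - ρ b.src| ≤ δ / (P.L : ℝ) ^ k := by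
    intro b
    have h1 : |D b.tgt - D b.src| ≤ 1 := by
      refine (hDlip b.tgt b.src).trans ?_
      rw [tdist_comm]
      exact_mod_cast tdist_shift_le_one b.src b.dir
    rw [hρsub, abs_mul, abs_of_nonneg hcoef]
    calc δ / (P.L : ℝ) ^ k * |D b.tgt - D b.src| ≤ δ / (P.L : ℝ) ^ k * 1 := mul_le_mul_of_nonneg_left h1 hcoef
      _ = δ / (P.L : ℝ) ^ k := mul_one _
  have hρblock : ∀ x x' : HiggsLattice.Site P 0, blockIter k x = blockIter k x' → |ρ x - ρ x'| ≤ δ := by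
    intro x x' hxx'
    have h1 : |D x - D x'| ≤ (P.L : ℝ) ^ k - 1 := (hDlip x x').trans (tdist_le_of_blockIter_eq_real hk hxx')
    rw [hρsub, abs_mul, abs_of_nonneg hcoef]
    calc δ / (P.L : ℝ) ^ k * |D x - D x'| ≤ δ / (P.L : ℝ) ^ k * ((P.L : ℝ) ^ k - 1) :=
          mul_le_mul_of_nonneg_left h1 hcoef
      _ = δ - δ / (P.L : ℝ) ^ k := by field_simp
      _ ≤ δ := by linarith
  have hρg' : ∀ x, g' x ≠ 0 → ρ x = 0 := by
    intro x hx
    rw [hρ]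
    simp only
    rw [hDzero x (Finset.mem_filter.mpr ⟨Finset.mem_univ _, hx⟩), mul_zero]
  -- the norm bound for w = e^ρ G g'
  have hwn := sNorm_conj_propagatorK_le C A hk Ω hΩ hmsq hak hγ hlow hδ0 hδ1 hδ ρ hρbond hρblock g' hg' hρg'
  obtain ⟨u, hu⟩ : ∃ u : ScalarField P 0 N, u = propagatorK C Ω A msq a k g' := ⟨_, rfl⟩
  obtain ⟨w, hw⟩ : ∃ w : ScalarField P 0 N, w = fun x => Real.exp (ρ x) • u x := ⟨_, rfl⟩
  rw [← hu] at hwn ⊢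
  rw [← hw] at hwn
  -- ⟨g, u⟩ = ⟨e^{-ρ}g, w⟩ and ‖e^{-ρ}g‖ ≤ e^{-δ r / L^k}‖g‖
  have hgu : siteInner g u = siteInner (fun x => Real.exp (-ρ x) • g x) w := by
    rw [hw]
    unfold siteInner
    refine Finset.sum_congr rfl fun x _ => ?_
    rw [real_inner_smul_left, real_inner_smul_right]
    have hee : Real.exp (-ρ x) * (Real.exp (ρ x) * ⟪g x, u x⟫_ℝ) = ⟪g x, u x⟫_ℝ := by
      rw [← mul_assoc, ← Real.exp_add, neg_add_cancel, Real.exp_zero, one_mul]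
    rw [hee]
  have hexpg : siteInner (fun x => Real.exp (-ρ x) • g x) (fun x => Real.exp (-ρ x) • g x)
      ≤ Real.exp (-(δ * (r / (P.L : ℝ) ^ k))) ^ 2 * siteInner g g := by
    rw [siteInner_self_eq, siteInner_self_eq, Finset.mul_sum]
    refine Finset.sum_le_sum fun x _ => ?_
    by_cases hgx : g x = 0
    · simp [hgx]
    · have hfar : r ≤ D x := hDfar x r fun x' hx' => hsep x x' hgx (Finset.mem_filter.mp hx').2
      have hρx : δ * (r / (P.L : ℝ) ^ k) ≤ ρ x := by
        have : δ * (r / (P.L : ℝ) ^ k) = δ / (P.L : ℝ) ^ k * r := by ring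
        rw [this, hρ]
        exact mul_le_mul_of_nonneg_left hfar hcoef
      have hex : Real.exp (-ρ x) ≤ Real.exp (-(δ * (r / (P.L : ℝ) ^ k))) := Real.exp_le_exp.mpr (by linarith)
      have hsq : Real.exp (-ρ x) ^ 2 ≤ Real.exp (-(δ * (r / (P.L : ℝ) ^ k))) ^ 2 :=
        pow_le_pow_left₀ (Real.exp_pos _).le hex 2
      have hm : 0 ≤ P.mesh 0 ^ P.d * ‖g x‖ ^ 2 := by
        have := P.mesh_pos 0
        positivity
      rw [norm_smul, Real.norm_eq_abs, abs_of_pos (Real.exp_pos _), mul_pow]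
      calc P.mesh 0 ^ P.d * (Real.exp (-ρ x) ^ 2 * ‖g x‖ ^ 2) = Real.exp (-ρ x) ^ 2 * (P.mesh 0 ^ P.d * ‖g x‖ ^ 2) := by
            ring
        _ ≤ Real.exp (-(δ * (r / (P.L : ℝ) ^ k))) ^ 2 * (P.mesh 0 ^ P.d * ‖g x‖ ^ 2) :=
            mul_le_mul_of_nonneg_right hsq hm
  have hsn : sNorm (fun x => Real.exp (-ρ x) • g x) ≤ Real.exp (-(δ * (r / (P.L : ℝ) ^ k))) * sNorm g := by
    unfold sNorm
    rw [← Real.sqrt_sq (Real.exp_pos (-(δ * (r / (P.L : ℝ) ^ k)))).le, ← Real.sqrt_mul (sq_nonneg _)]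
    exact Real.sqrt_le_sqrt hexpg
  -- assemble
  calc |siteInner g u| = |siteInner (fun x => Real.exp (-ρ x) • g x) w| := by rw [hgu]
    _ ≤ sNorm (fun x => Real.exp (-ρ x) • g x) * sNorm w := abs_siteInner_le _ _
    _ ≤ (Real.exp (-(δ * (r / (P.L : ℝ) ^ k))) * sNorm g) * (2 / γ * P.mesh k ^ 2 * sNorm g') :=
        mul_le_mul hsn hwn (sNorm_nonneg _) (mul_nonneg (Real.exp_pos _).le (sNorm_nonneg _))
    _ = 2 / γ * P.mesh k ^ 2 * Real.exp (-(δ * (r / (P.L : ℝ) ^ k))) *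
        Real.sqrt (siteInner g g) * Real.sqrt (siteInner g' g') := by
        unfold sNorm
        ring

end Pairing

/-! ## §5 Corollary 2.3 (2.30), first pairing, at a regular `A` for regions `Ω ⊂ T_ε`: r14 g14's (1.8) plugged in -/

section Region

variable (C : ChargeData N) {msq a : ℝ}

/-- **Admissible exponents for the regular-field constant**: if `0 ≤ δ` and `(4d + 4a)δ ≤ γ₀ = min{2, a(1 − L^{−2})/4}` then `δ ≤ 1`
and the error budget `2(2dδ² + 2a_kδ) ≤ γ₀` of `pairing_of_coercive` holds for every `k ≥ 1` (`a_k ≤ a`, (2.15)).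
[cite: Balaban1982Higgs1, (2.15) p.609] -/
theorem delta_admissible (ha : 0 < a) (hL : 1 < P.L) (hk1 : 1 ≤ k) {δ : ℝ} (hδ0 : 0 ≤ δ)
    (hδ : (4 * P.d + 4 * a) * δ ≤ min 2 (a * (1 - ((P.L : ℝ) ^ 2)⁻¹) / 4)) :
    δ ≤ 1 ∧ 2 * (2 * P.d * δ ^ 2 + B1.aSeq a P.L k * (2 * δ)) ≤ min 2 (a * (1 - ((P.L : ℝ) ^ 2)⁻¹) / 4) := by
  have hL' : (1 : ℝ) < (P.L : ℝ) := by exact_mod_cast hL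
  have hinv : 0 < ((P.L : ℝ) ^ 2)⁻¹ := by positivity
  have hγa : min 2 (a * (1 - ((P.L : ℝ) ^ 2)⁻¹) / 4) < a := by
    have : a * (1 - ((P.L : ℝ) ^ 2)⁻¹) / 4 < a := by nlinarith
    exact lt_of_le_of_lt (min_le_right _ _) this
  have hd : (0 : ℝ) ≤ P.d := Nat.cast_nonneg _
  have hδ1 : δ ≤ 1 := by
    by_contra h
    have h' : 1 < δ := not_le.mp h
    nlinarith
  have hak : B1.aSeq a P.L k ≤ a := B1.aSeq_le ha hL' k hk1
  have hakpos : 0 ≤ B1.aSeq a P.L k := (B1.aSeq_pos ha hL' hk1).le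
  refine ⟨hδ1, ?_⟩
  have h1 : δ ^ 2 ≤ δ := by nlinarith
  have h2 : B1.aSeq a P.L k * (2 * δ) ≤ a * (2 * δ) := mul_le_mul_of_nonneg_right hak (by linarith)
  have h3 : 2 * P.d * δ ^ 2 ≤ 2 * P.d * δ := mul_le_mul_of_nonneg_left h1 (by linarith)
  linarith

/-- **[13] COROLLARY 2.3 (2.30), FIRST PAIRING, AT A REGULAR `A ≠ 0` FOR REGIONS `Ω ⊂ T_ε` ON THE CONCRETE CARRIER** (p. 580 *"If Ω
and A are as in Proposition I.2.1, then there exist positive constants c₀, δ₀ such that for arbitrary scalar field configurations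
f, f′ defined on Ω, we have |⟨f, G_k(Ω,A)f′⟩| … ≤ c₀e^{−δ₀dist(supp f, supp f′)}‖f‖₂‖f′‖₂"*, in the `ε`-units of [B1] (2.20)): for `Ω`
ANY union of `k`-fold blocks of the torus (`1 ≤ k ≤ K`), `m² > 0`, `a > 0`, `L > 1`, every `δ ≥ 0` with `(4d + 4a)δ ≤ γ₀ =
min{2, a(1 − L^{−2})/4}`, EVERY `A` whose one-step differences are `≤ δ_A` at the sites of `Ω` with `d²·ε|e|·L^{2k}·δ_A ≤ 1/3`, every `g`,
every `g′` supported in `Ω` and every `r ≤ |x − x′|` on `supp g × supp g′`: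
`|⟨g, G^ε_k(Ω,A)g′⟩| ≤ (2/γ₀)(L^kε)²·e^{−δr/L^k}·‖g‖‖g′‖` — constants independent of `ε`, `Ω`, the torus, `k`, `m²` and `A`.
[cite: Balaban1983RegularityDecay, Cor. 2.3 (2.30) p.580] -/
theorem propagatorK_pairing_regular_region (ha : 0 < a) (hL : 1 < P.L) (hmsq : 0 < msq) (hk1 : 1 ≤ k) (hk : k ≤ P.K)
    (Ω : Finset (HiggsLattice.Site P 0))
    (hΩ : ∀ x x' : HiggsLattice.Site P 0, blockIter k x = blockIter k x' → (x ∈ Ω ↔ x' ∈ Ω))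
    (A : HiggsLattice.VecField P 0) {δA : ℝ}
    (hreg : ∀ z ∈ Ω, ∀ μ ν : Fin P.d, |A ⟨z.shift ν, μ⟩ - A ⟨z, μ⟩| ≤ δA)
    (hsmall : (P.d : ℝ) ^ 2 * (P.mesh 0 * |C.e|) * ((P.L : ℝ) ^ k) ^ 2 * δA ≤ 1 / 3)
    {δ : ℝ} (hδ0 : 0 ≤ δ) (hδ : (4 * P.d + 4 * a) * δ ≤ min 2 (a * (1 - ((P.L : ℝ) ^ 2)⁻¹) / 4))
    (g g' : ScalarField P 0 N) (hg' : ∀ x, x ∉ Ω → g' x = 0) (r : ℝ)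
    (hsep : ∀ x x', g x ≠ 0 → g' x' ≠ 0 → r ≤ (HiggsLattice.Site.tdist x x' : ℝ)) :
    |siteInner g (propagatorK C Ω A msq a k g')| ≤
      2 / min 2 (a * (1 - ((P.L : ℝ) ^ 2)⁻¹) / 4) * P.mesh k ^ 2 * Real.exp (-(δ * (r / (P.L : ℝ) ^ k))) *
        Real.sqrt (siteInner g g) * Real.sqrt (siteInner g' g') := by
  have hL' : (1 : ℝ) < (P.L : ℝ) := by exact_mod_cast hL
  have hak : 0 ≤ B1.aSeq a P.L k := (B1.aSeq_pos ha hL' hk1).le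
  have hγ := gammaReg_pos (P := P) ha hL
  obtain ⟨hδ1, hbud⟩ := delta_admissible (P := P) (k := k) ha hL hk1 hδ0 hδ
  refine pairing_of_coercive C A hk Ω hΩ hmsq hak hγ ?_ hδ0 hδ1 hbud g g' hg' r hsep
  intro w hw
  have h := coercive_covOpK_regular_region_uniform C (msq := msq) ha hL hk1 hk Ω hΩ A hreg hsmall w hw
  have : 0 ≤ msq * siteInner w w := mul_nonneg hmsq.le (siteInner_self_nonneg w)
  linarith

/-- **The same in the shape of the displayed input `hSep`** of the (5.4) chain (sources supported in `Ω`): for `L^kε ≤ 1` the constant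
is `c₀ = 2/γ₀`, the SAME for all `k`, `ε`, `Ω`, tori, `m² > 0` and all `A` regular on `Ω` below the threshold.
[cite: Balaban1983RegularityDecay, Cor. 2.3 (2.30) p.580] -/
theorem propagatorK_pairing_regular_region_sep (ha : 0 < a) (hL : 1 < P.L) (hmsq : 0 < msq) (hk1 : 1 ≤ k) (hk : k ≤ P.K)
    (hs : P.mesh k ≤ 1) (Ω : Finset (HiggsLattice.Site P 0))
    (hΩ : ∀ x x' : HiggsLattice.Site P 0, blockIter k x = blockIter k x' → (x ∈ Ω ↔ x' ∈ Ω))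
    (A : HiggsLattice.VecField P 0) {δA : ℝ}
    (hreg : ∀ z ∈ Ω, ∀ μ ν : Fin P.d, |A ⟨z.shift ν, μ⟩ - A ⟨z, μ⟩| ≤ δA)
    (hsmall : (P.d : ℝ) ^ 2 * (P.mesh 0 * |C.e|) * ((P.L : ℝ) ^ k) ^ 2 * δA ≤ 1 / 3)
    {δ : ℝ} (hδ0 : 0 ≤ δ) (hδ : (4 * P.d + 4 * a) * δ ≤ min 2 (a * (1 - ((P.L : ℝ) ^ 2)⁻¹) / 4))
    (r : ℝ) (g g' : ScalarField P 0 N) (hg' : ∀ x, x ∉ Ω → g' x = 0)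
    (hsep : ∀ x x', g x ≠ 0 → g' x' ≠ 0 → r ≤ (HiggsLattice.Site.tdist x x' : ℝ)) :
    |siteInner g (propagatorK C Ω A msq a k g')| ≤
      2 / min 2 (a * (1 - ((P.L : ℝ) ^ 2)⁻¹) / 4) * Real.exp (-(δ * (r / (P.L : ℝ) ^ k))) *
        Real.sqrt (siteInner g g) * Real.sqrt (siteInner g' g') := by
  have h := propagatorK_pairing_regular_region C ha hL hmsq hk1 hk Ω hΩ A hreg hsmall hδ0 hδ g g' hg' r hsep
  have hγ := gammaReg_pos (P := P) ha hL
  have hM2 : P.mesh k ^ 2 ≤ 1 := by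
    have := P.mesh_pos k
    nlinarith
  have hnn : 0 ≤ 2 / min 2 (a * (1 - ((P.L : ℝ) ^ 2)⁻¹) / 4) * Real.exp (-(δ * (r / (P.L : ℝ) ^ k))) *
      Real.sqrt (siteInner g g) * Real.sqrt (siteInner g' g') := by positivity
  calc |siteInner g (propagatorK C Ω A msq a k g')|
      ≤ 2 / min 2 (a * (1 - ((P.L : ℝ) ^ 2)⁻¹) / 4) * P.mesh k ^ 2 * Real.exp (-(δ * (r / (P.L : ℝ) ^ k))) *
        Real.sqrt (siteInner g g) * Real.sqrt (siteInner g' g') := h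
    _ = P.mesh k ^ 2 * (2 / min 2 (a * (1 - ((P.L : ℝ) ^ 2)⁻¹) / 4) * Real.exp (-(δ * (r / (P.L : ℝ) ^ k))) *
        Real.sqrt (siteInner g g) * Real.sqrt (siteInner g' g')) := by ring
    _ ≤ 1 * (2 / min 2 (a * (1 - ((P.L : ℝ) ^ 2)⁻¹) / 4) * Real.exp (-(δ * (r / (P.L : ℝ) ^ k))) *
        Real.sqrt (siteInner g g) * Real.sqrt (siteInner g' g')) := mul_le_mul_of_nonneg_right hM2 hnn
    _ = _ := one_mul _

/-- **The printed quantifier shape**: for `L > 1`, `a > 0` and every `d` there are `δ₀, c₀ > 0` (`δ₀ = γ₀/(4d + 4a)`, `c₀ = 2/γ₀`,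
`γ₀ = min{2, a(1 − L^{−2})/4}`) such that for EVERY torus of the model with these `d, L` (every volume, every `ε`), every charge data,
every `m² > 0`, every level `1 ≤ k ≤ K` with `L^kε ≤ 1`, every union `Ω` of `k`-fold blocks, EVERY vector field `A` whose one-step
differences are `≤ δ_A` at the sites of `Ω` with `d²·ε|e|·L^{2k}·δ_A ≤ 1/3` («A as in Proposition I.2.1»), every `g`, every `g′` supported
in `Ω` and every `r ≤ dist(supp g, supp g′)`: `|⟨g, G^ε_k(Ω,A)g′⟩| ≤ c₀e^{−δ₀r/L^k}‖g‖‖g′‖`.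
[cite: Balaban1983RegularityDecay, Cor. 2.3 (2.30) p.580] [cite: Balaban1982Higgs1, Prop. 2.1 (2.23) p.610] -/
theorem cor23_first_regular_region (d L : ℕ) (hL : 1 < L) {a : ℝ} (ha : 0 < a) :
    ∃ δ₀ c₀ : ℝ, 0 < δ₀ ∧ 0 < c₀ ∧
      ∀ (P : HiggsLattice.Params), P.d = d → P.L = L → ∀ (N : ℕ) (C : ChargeData N) (msq : ℝ), 0 < msq →
        ∀ (k : ℕ), 1 ≤ k → k ≤ P.K → P.mesh k ≤ 1 →
          ∀ (Ω : Finset (HiggsLattice.Site P 0)),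
            (∀ x x' : HiggsLattice.Site P 0, blockIter k x = blockIter k x' → (x ∈ Ω ↔ x' ∈ Ω)) →
              ∀ (A : HiggsLattice.VecField P 0) (δA : ℝ),
                (∀ z ∈ Ω, ∀ μ ν : Fin P.d, |A ⟨z.shift ν, μ⟩ - A ⟨z, μ⟩| ≤ δA) →
                (P.d : ℝ) ^ 2 * (P.mesh 0 * |C.e|) * ((P.L : ℝ) ^ k) ^ 2 * δA ≤ 1 / 3 →
                  ∀ (r : ℝ) (g g' : ScalarField P 0 N), (∀ x, x ∉ Ω → g' x = 0) →
                    (∀ x x', g x ≠ 0 → g' x' ≠ 0 → r ≤ (HiggsLattice.Site.tdist x x' : ℝ)) →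
                      |siteInner g (propagatorK C Ω A msq a k g')| ≤
                        c₀ * Real.exp (-(δ₀ * (r / (P.L : ℝ) ^ k))) *
                          Real.sqrt (siteInner g g) * Real.sqrt (siteInner g' g') := by
  have hL' : (1 : ℝ) < (L : ℝ) := by exact_mod_cast hL
  have hinv : ((L : ℝ) ^ 2)⁻¹ < 1 := inv_lt_one_of_one_lt₀ (by nlinarith)
  have hγ : 0 < min 2 (a * (1 - ((L : ℝ) ^ 2)⁻¹) / 4) :=
    lt_min (by norm_num) (by nlinarith [mul_pos ha (show (0:ℝ) < 1 - ((L : ℝ) ^ 2)⁻¹ by linarith)])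
  have hden : (0 : ℝ) < 4 * d + 4 * a := by positivity
  refine ⟨min 2 (a * (1 - ((L : ℝ) ^ 2)⁻¹) / 4) / (4 * d + 4 * a), 2 / min 2 (a * (1 - ((L : ℝ) ^ 2)⁻¹) / 4),
    div_pos hγ hden, div_pos two_pos hγ, ?_⟩
  intro P hPd hPL N C msq hmsq k hk1 hk hs Ω hΩ A δA hreg hsmall r g g' hg' hsep
  subst hPd hPL
  have hPL1 : 1 < P.L := hL
  exact propagatorK_pairing_regular_region_sep C ha hPL1 hmsq hk1 hk hs Ω hΩ A hreg hsmall (div_pos hγ hden).le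
    (le_of_eq (mul_div_cancel₀ _ hden.ne')) r g g' hg' hsep

/-- **The same with the regularity in the printed (2.23) currency** (the bond-by-bond form `(L^kε|e|/e_k)·|A_μ(z + εe_ν) − A_μ(z)| ≦
c·e_k^{β−1}/L^k` at the sites of `Ω`, `e_k > 0`): for `L > 1`, `a > 0`, `d` and a regularity constant `c` there are `δ₀, c₀, E₁ > 0`
(`E₁ = 1/(3c·d²)` for `c > 0`) such that the pairing bound holds for every such `A` with `e_k^β ≤ E₁` — «for e(L^kε) sufficiently small».
[cite: Balaban1983RegularityDecay, Cor. 2.3 (2.30) p.580] [cite: Balaban1982Higgs1, Prop. 2.1 (2.23) p.610] -/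
theorem cor23_first_reg223_region (d L : ℕ) (hL : 1 < L) {a : ℝ} (ha : 0 < a) {creg : ℝ} (hcreg : 0 ≤ creg) (β : ℝ) :
    ∃ δ₀ c₀ E₁ : ℝ, 0 < δ₀ ∧ 0 < c₀ ∧ 0 < E₁ ∧
      ∀ (P : HiggsLattice.Params), P.d = d → P.L = L → ∀ (N : ℕ) (C : ChargeData N) (msq : ℝ), 0 < msq →
        ∀ (k : ℕ), 1 ≤ k → k ≤ P.K → P.mesh k ≤ 1 →
          ∀ (Ω : Finset (HiggsLattice.Site P 0)),
            (∀ x x' : HiggsLattice.Site P 0, blockIter k x = blockIter k x' → (x ∈ Ω ↔ x' ∈ Ω)) →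
              ∀ (A : HiggsLattice.VecField P 0) (ec : ℝ), 0 < ec → ec ^ β ≤ E₁ →
                (∀ z ∈ Ω, ∀ μ ν : Fin P.d,
                  P.mesh k * |C.e| / ec * |A ⟨z.shift ν, μ⟩ - A ⟨z, μ⟩| ≤ creg * ec ^ (β - 1) / (P.L : ℝ) ^ k) →
                  ∀ (r : ℝ) (g g' : ScalarField P 0 N), (∀ x, x ∉ Ω → g' x = 0) →
                    (∀ x x', g x ≠ 0 → g' x' ≠ 0 → r ≤ (HiggsLattice.Site.tdist x x' : ℝ)) →
                      |siteInner g (propagatorK C Ω A msq a k g')| ≤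
                        c₀ * Real.exp (-(δ₀ * (r / (P.L : ℝ) ^ k))) *
                          Real.sqrt (siteInner g g) * Real.sqrt (siteInner g' g') := by
  have hL' : (1 : ℝ) < (L : ℝ) := by exact_mod_cast hL
  have hinv : ((L : ℝ) ^ 2)⁻¹ < 1 := inv_lt_one_of_one_lt₀ (by nlinarith)
  have hγ : 0 < min 2 (a * (1 - ((L : ℝ) ^ 2)⁻¹) / 4) :=
    lt_min (by norm_num) (by nlinarith [mul_pos ha (show (0:ℝ) < 1 - ((L : ℝ) ^ 2)⁻¹ by linarith)])
  have hden : (0 : ℝ) < 4 * d + 4 * a := by positivity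
  have hE : (0 : ℝ) < 1 / (3 * (creg + 1) * ((d : ℝ) ^ 2 + 1)) := by positivity
  refine ⟨min 2 (a * (1 - ((L : ℝ) ^ 2)⁻¹) / 4) / (4 * d + 4 * a), 2 / min 2 (a * (1 - ((L : ℝ) ^ 2)⁻¹) / 4),
    1 / (3 * (creg + 1) * ((d : ℝ) ^ 2 + 1)), div_pos hγ hden, div_pos two_pos hγ, hE, ?_⟩
  intro P hPd hPL N C msq hmsq k hk1 hk hs Ω hΩ A ec hec hecE hreg r g g' hg' hsep
  subst hPd hPL
  have hPL1 : 1 < P.L := hL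
  have hPL' : (1 : ℝ) < (P.L : ℝ) := by exact_mod_cast hPL1
  have hak : 0 ≤ B1.aSeq a P.L k := (B1.aSeq_pos ha hPL' hk1).le
  have hγP := gammaReg_pos (P := P) ha hPL1
  obtain ⟨hδ1, hbud⟩ := delta_admissible (P := P) (k := k) ha hPL1 hk1 (div_pos hγ hden).le
    (le_of_eq (mul_div_cancel₀ _ hden.ne'))
  -- the smallness in the (2.23) currency
  have hecβ : 0 ≤ ec ^ β := (Real.rpow_pos_of_pos hec β).le
  have hsmall : (P.d : ℝ) ^ 2 * creg * ec ^ β ≤ 1 / 3 := by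
    have h1 : (P.d : ℝ) ^ 2 * creg ≤ ((P.d : ℝ) ^ 2 + 1) * (creg + 1) := by nlinarith [sq_nonneg (P.d : ℝ)]
    have h2 : (P.d : ℝ) ^ 2 * creg * ec ^ β ≤ ((P.d : ℝ) ^ 2 + 1) * (creg + 1) * ec ^ β :=
      mul_le_mul_of_nonneg_right h1 hecβ
    have h3 : ((P.d : ℝ) ^ 2 + 1) * (creg + 1) * ec ^ β ≤ ((P.d : ℝ) ^ 2 + 1) * (creg + 1) * (1 / (3 * (creg + 1) * ((P.d : ℝ) ^ 2 + 1))) :=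
      mul_le_mul_of_nonneg_left hecE (by positivity)
    have h4 : ((P.d : ℝ) ^ 2 + 1) * (creg + 1) * (1 / (3 * (creg + 1) * ((P.d : ℝ) ^ 2 + 1))) = 1 / 3 := by
      field_simp
    linarith
  have hpair := pairing_of_coercive C A hk Ω hΩ hmsq hak hγP ?_ (div_pos hγ hden).le hδ1 hbud g g' hg' r hsep
  · have hM2 : P.mesh k ^ 2 ≤ 1 := by
      have := P.mesh_pos k
      nlinarith
    have hnn : 0 ≤ 2 / min 2 (a * (1 - ((P.L : ℝ) ^ 2)⁻¹) / 4) *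
        Real.exp (-(min 2 (a * (1 - ((P.L : ℝ) ^ 2)⁻¹) / 4) / (4 * P.d + 4 * a) * (r / (P.L : ℝ) ^ k))) *
        Real.sqrt (siteInner g g) * Real.sqrt (siteInner g' g') := by positivity
    calc |siteInner g (propagatorK C Ω A msq a k g')|
        ≤ 2 / min 2 (a * (1 - ((P.L : ℝ) ^ 2)⁻¹) / 4) * P.mesh k ^ 2 *
          Real.exp (-(min 2 (a * (1 - ((P.L : ℝ) ^ 2)⁻¹) / 4) / (4 * P.d + 4 * a) * (r / (P.L : ℝ) ^ k))) *
          Real.sqrt (siteInner g g) * Real.sqrt (siteInner g' g') := hpair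
      _ = P.mesh k ^ 2 * (2 / min 2 (a * (1 - ((P.L : ℝ) ^ 2)⁻¹) / 4) *
          Real.exp (-(min 2 (a * (1 - ((P.L : ℝ) ^ 2)⁻¹) / 4) / (4 * P.d + 4 * a) * (r / (P.L : ℝ) ^ k))) *
          Real.sqrt (siteInner g g) * Real.sqrt (siteInner g' g')) := by ring
      _ ≤ 1 * (2 / min 2 (a * (1 - ((P.L : ℝ) ^ 2)⁻¹) / 4) *
          Real.exp (-(min 2 (a * (1 - ((P.L : ℝ) ^ 2)⁻¹) / 4) / (4 * P.d + 4 * a) * (r / (P.L : ℝ) ^ k))) *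
          Real.sqrt (siteInner g g) * Real.sqrt (siteInner g' g')) := mul_le_mul_of_nonneg_right hM2 hnn
      _ = _ := one_mul _
  · intro w hw
    have h := coercive_covOpK_of_reg223 C ha hPL1 hk1 hk Ω hΩ A hec hreg hsmall msq w hw
    have : 0 ≤ msq * siteInner w w := mul_nonneg hmsq.le (siteInner_self_nonneg w)
    linarith

end Region

end Literature.MathematicalPhysics.QuantumFieldTheory.Balaban1983to89.B1Cor23RegularRegion

end
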